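import Summits.KontsevichZagierPeriods.KontsevichZagierPeriods.Theses.FurushoPentagon
import Summits.KontsevichZagierPeriods.KontsevichZagierPeriods.Theorems.FurushoPentagonKernelModuloPeriodConjectureLeafWeightLeSixteen
import Summits.KontsevichZagierPeriods.KontsevichZagierPeriods.Theorems.FurushoPentagonKernelModuloPeriodConjectureLeafOfDual
import Summits.KontsevichZagierPeriods.KontsevichZagierPeriods.Theorems.FurushoPentagonKernelModuloPeriodConjectureLeafLowWeight
import Summits.KontsevichZagierPeriods.KontsevichZagierPeriods.Theorems.FurushoPentagonKernelModuloPeriodConjectureReplicateEvenLeaf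
import Summits.KontsevichZagierPeriods.KontsevichZagierPeriods.Theorems.FurushoPentagonKernelModuloPeriodConjecturePowerFormReplicate
import Summits.KontsevichZagierPeriods.KontsevichZagierPeriods.Theorems.FurushoPentagonKernelModuloPeriodConjectureThreeOneLeaf
import Summits.KontsevichZagierPeriods.KontsevichZagierPeriods.Theorems.FurushoPentagonKernelModuloPeriodConjectureShuffleTwosAlternating
import Literature.NumberTheory.Transcendental.MultipleZetaThreeOneProofs
import Literature.NumberTheory.Transcendental.MZVDualIndex

/-!
# Crux `AssociatorHoffmanSpanning` (child 1 of the glued split of `FurushoPentagon.KernelModuloPeriodConjecture`,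
stmt-KontsevichZagierPeriods-15058) — line `weight-frontier`, birth skeleton (planner-cstrat, 2026-08-17)

The crux A (the ALGEBRAIC LEAF): for every admissible index `s` ONE finitely supported `b : List ℕ →₀ ℚ`
on Hoffman indices of the same weight with `c_{binaryWord s}(φ) = Σ_t b_t · c_{binaryWord t}(φ)` at
every group-like solution `φ` of Drinfeld's pentagon over every REDUCED commutative `ℚ`-algebra — the
Hoffman words span `𝒪(GroupLike ∩ Pent)_red` weight by weight, the coordinate form of
`GRT₁ ≅ U^{dR}_{MT(ℤ)}` (Drinfeld 1991; Furusho 2011 §1; Brown 2012 Thm 1.1 for the motivic side).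
OPEN as a whole; THEOREM-GRADE WEIGHT BY WEIGHT: weights `≤ 16` are the tree theorem
`stub_associatorHoffmanSpanning_of_weight_le_16` (lead lines c0–c6 on the parent crux: exact-`ℚ`
certificates in weights 5–9, the GF(2) rank engine `LinEDS` with depth blocks / grouped rows /
compacted slots in weights 10–16), the infinite families `{2c}ᵐ ⊇ (2n)` (Euler) and `{3,1}ⁿ`
(Zagier–Broadhurst) and their duals in every weight (`stub_replicateEvenLeaf`, `stub_threeOneLeaf`,
`stub_leafOfDual`, all landed).

This skeleton is the parent line `Sketch` (lead c7, v16) CUT AT THE CHILD: the same weight frontier,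
now concluding the child crux by name. Registered stubs:
* `stub_leafWeightSeventeen` — the weight-17 slice (theorem-grade; lead c7's cell-block certificate,
  engine v4 `LinEDSCells`, 19–22 blocks of ≤ 2100 columns, landing as `…EdsBlockWeightSeventeen*`);
* `stub_residual_ge_18` — weights `≥ 18` off the landed infinite families and off the duals of Hoffman
  words (OPEN: `𝔤𝔯𝔱₁ = 𝔤^𝔪` coordinatewise in high weight; decidable weight by weight by the engine;
  the honest open remainder of A).
Composition `AssociatorHoffmanSpanning_of` (proved, no sorry): case split on the weight and on the
families, exactly as the parent's `associatorHoffmanSpanning_all`.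

Disproof used (parent `Cruxes/KernelModuloPeriodConjecture/Disproof.lean` §5, landed under
`Theorems/KernelModuloPeriodConjecture/Negative/`): `stubA_false_without_pentagon` — both stubs keep
the hypothesis `DrinfeldPentagon φ` (load-bearing already in weight 3); `not_stubAIntegral` — the
certificates `b` are ℚ-valued (denominators 3, 5, … are genuine), never ℤ-valued; `not_stubADepthCompatible`
— no stub asks for a depth-filtered reduction; `hoffmanSpan_eq_mzvSpace_of_stubA` — A at `Φ_KZ` is
Brown's spanning theorem, so A is NOT summit-implied (this is what makes the split a genuine redirect).

References: V. Drinfeld, Leningrad Math. J. 2 (1991); H. Furusho, Ann. of Math. 174 (2011) Thm 1.2;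
F. Brown, Ann. of Math. 175 (2012) Thm 1.1; K. Ihara, M. Kaneko, D. Zagier, Compos. Math. 142 (2006)
§2, p. 315; M. Hoffman, J. Algebra 194 (1997).
-/

noncomputable section

set_option linter.dupNamespace false

namespace Summit.KontsevichZagierPeriods.KontsevichZagierPeriods.Cruxes.AssociatorHoffmanSpanning.WeightFrontier

open Literature.NumberTheory.Transcendental
open Summit.KontsevichZagierPeriods.KontsevichZagierPeriods.Theses.FurushoPentagon
open Summit.KontsevichZagierPeriods.FurushoPentagon.KernelModuloPeriodConjecture
  (stub_associatorHoffmanSpanning_of_weight_le_16 stub_leafOfDual leafLowWeight_of_isHoffman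
   stub_replicateEvenLeaf stub_powerFormReplicate stub_threeOneLeaf stub_shuffleTwosAlternating)

/-- PRE-SPLIT COPY of the child crux, verbatim the statement filed in children.json (replaced by the
route decl `…Theses.FurushoPentagon.AssociatorHoffmanSpanning` once the gate has written it). -/
def AssociatorHoffmanSpanning : Prop :=
  ∀ s : List ℕ, Literature.NumberTheory.Transcendental.MZV.IsAdmissible s → ∃ b : List ℕ →₀ ℚ, (∀ t ∈ b.support, Literature.NumberTheory.Transcendental.MZV.IsHoffman t ∧ Literature.NumberTheory.Transcendental.MZV.weight t = Literature.NumberTheory.Transcendental.MZV.weight s) ∧ ∀ (R : Type) [CommRing R] [Algebra ℚ R] [IsReduced R] (φ : Literature.NumberTheory.Transcendental.NCSeries Bool R), Literature.NumberTheory.Transcendental.NCSeries.IsGroupLike φ → Literature.NumberTheory.Transcendental.NCSeries.DrinfeldPentagon φ → φ (Literature.NumberTheory.Transcendental.MZV.binaryWord s) = b.sum (fun t q => q • φ (Literature.NumberTheory.Transcendental.MZV.binaryWord t))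

/-! ## Registered stubs -/

/-- **A₁₇ — the weight-17 slice of the leaf** (theorem-grade: `2^15 − d₁₇` non-Hoffman admissible
words of weight 17 reduce to the `d₁₇ = 49` Hoffman words at every group-like pentagon solution over
every reduced commutative `ℚ`-algebra; lead c7's cell-block certificate of the parent line).
[cite: IharaKanekoZagier2006, Conjecture 1] -/
theorem stub_leafWeightSeventeen :
    ∀ s : List ℕ, MZV.IsAdmissible s → MZV.weight s = 17 →
      ∃ b : List ℕ →₀ ℚ, (∀ t ∈ b.support, MZV.IsHoffman t ∧ MZV.weight t = MZV.weight s) ∧ ∀ (R : Type) [CommRing R] [Algebra ℚ R] [IsReduced R] (φ : NCSeries Bool R), NCSeries.IsGroupLike φ → NCSeries.DrinfeldPentagon φ → φ (MZV.binaryWord s) = b.sum (fun t q => q • φ (MZV.binaryWord t)) := by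
  sorry

/-- **A_res — the residual algebraic leaf in weights `≥ 18`**, off the landed infinite families
`{2c}ᵐ ⊇ (2n)`, `{3,1}ⁿ`, their duals, and off the duals of the Hoffman words (OPEN: the coordinate
form of `GRT₁ ≅ U^{dR}_{MT(ℤ)}` weight by weight; decidable per weight). Verbatim the parent line's
`stub_associatorHoffmanSpanning_residual` (v16). [cite: Brown2012, Thm 1.1] -/
theorem stub_residual_ge_18 :
    ∀ s : List ℕ, MZV.IsAdmissible s → 18 ≤ MZV.weight s →
      (∀ c m : ℕ, 1 ≤ c → 1 ≤ m → s ≠ List.replicate m (2 * c)) →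
      (∀ n : ℕ, s ≠ (List.replicate n [3, 1]).flatten) →
      (∀ c m : ℕ, 1 ≤ c → 1 ≤ m → MZV.dual s ≠ List.replicate m (2 * c)) →
      ¬ MZV.IsHoffman (MZV.dual s) →
      ∃ b : List ℕ →₀ ℚ, (∀ t ∈ b.support, MZV.IsHoffman t ∧ MZV.weight t = MZV.weight s) ∧ ∀ (R : Type) [CommRing R] [Algebra ℚ R] [IsReduced R] (φ : NCSeries Bool R), NCSeries.IsGroupLike φ → NCSeries.DrinfeldPentagon φ → φ (MZV.binaryWord s) = b.sum (fun t q => q • φ (MZV.binaryWord t)) := by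
  sorry

/-! ## Glue (proved) — the families and the weight partition, as in the parent line -/

/-- Packaging: a one-term Hoffman expansion `c_s(φ) = r c_t(φ)` in the leaf's `Finsupp` form. [folklore] -/
theorem leaf_of_single {s t : List ℕ} (ht : MZV.IsHoffman t) (hw : MZV.weight t = MZV.weight s) {r : ℚ}
    (h : ∀ (R : Type) [CommRing R] [Algebra ℚ R] (φ : NCSeries Bool R),
      NCSeries.IsGroupLike φ → NCSeries.DrinfeldPentagon φ →
        φ (MZV.binaryWord s) = r • φ (MZV.binaryWord t)) :
    ∃ b : List ℕ →₀ ℚ, (∀ t ∈ b.support, MZV.IsHoffman t ∧ MZV.weight t = MZV.weight s) ∧ ∀ (R : Type) [CommRing R] [Algebra ℚ R] [IsReduced R] (φ : NCSeries Bool R), NCSeries.IsGroupLike φ → NCSeries.DrinfeldPentagon φ → φ (MZV.binaryWord s) = b.sum (fun t q => q • φ (MZV.binaryWord t)) := by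
  refine ⟨Finsupp.single t r, fun u hu => ?_, fun R _ _ _ φ hg h5 => ?_⟩
  · have hut : u = t := by
      by_contra hne
      exact (Finsupp.mem_support_iff.mp hu) (Finsupp.single_eq_of_ne hne)
    subst hut
    exact ⟨ht, hw⟩
  · rw [h R φ hg h5]
    exact (Finsupp.sum_single_index (h := fun t q => q • φ (MZV.binaryWord t)) (zero_smul ℚ _)).symm

/-- `{2}ᵏ` is a Hoffman index of weight `2k`. [folklore] -/
theorem isHoffman_twos_and_weight (k : ℕ) :
    MZV.IsHoffman (List.replicate k 2) ∧ MZV.weight (List.replicate k 2) = 2 * k :=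
  ⟨fun i hi => Or.inl (List.eq_of_mem_replicate hi), by simp [MZV.weight, List.sum_replicate]; ring⟩

/-- The repeated-even-letter family `{2c}ᵐ`, leaf form (Euler for associators at `m = 1`).
[cite: Hoffman1992, Theorem 2.2] -/
theorem leaf_replicateEven (c m : ℕ) (hc : 1 ≤ c) (hm : 1 ≤ m) :
    ∃ b : List ℕ →₀ ℚ, (∀ t ∈ b.support, MZV.IsHoffman t ∧ MZV.weight t = MZV.weight (List.replicate m (2 * c))) ∧ ∀ (R : Type) [CommRing R] [Algebra ℚ R] [IsReduced R] (φ : NCSeries Bool R), NCSeries.IsGroupLike φ → NCSeries.DrinfeldPentagon φ → φ (MZV.binaryWord (List.replicate m (2 * c))) = b.sum (fun t q => q • φ (MZV.binaryWord t)) := by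
  obtain ⟨r, hr⟩ := stub_replicateEvenLeaf stub_powerFormReplicate c m hc hm
  exact leaf_of_single (isHoffman_twos_and_weight (c * m)).1
    (by rw [(isHoffman_twos_and_weight (c * m)).2]; simp [MZV.weight, List.sum_replicate]; ring) hr

/-- The Zagier–Broadhurst family `{3,1}ⁿ`, leaf form. [cite: BBBL1998, §6 Theorem 1] -/
theorem leaf_threeOne (n : ℕ) :
    ∃ b : List ℕ →₀ ℚ, (∀ t ∈ b.support, MZV.IsHoffman t ∧ MZV.weight t = MZV.weight (List.replicate n [3, 1]).flatten) ∧ ∀ (R : Type) [CommRing R] [Algebra ℚ R] [IsReduced R] (φ : NCSeries Bool R), NCSeries.IsGroupLike φ → NCSeries.DrinfeldPentagon φ → φ (MZV.binaryWord (List.replicate n [3, 1]).flatten) = b.sum (fun t q => q • φ (MZV.binaryWord t)) := by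
  obtain ⟨r, hr⟩ := stub_threeOneLeaf stub_shuffleTwosAlternating stub_powerFormReplicate n
  exact leaf_of_single (isHoffman_twos_and_weight (2 * n)).1
    (by rw [(isHoffman_twos_and_weight (2 * n)).2, weight_threeOne]; ring) hr

/-! ## The crux from the stubs, by name -/

/-- **The leaf from its two slices (arrow form, helper).** Weight `≤ 16` is the tree theorem, weight 17
is the first hypothesis, the infinite families and duals are landed, the rest is the second. [folklore] -/
theorem associatorHoffmanSpanning_of_slices :
    (∀ s : List ℕ, MZV.IsAdmissible s → MZV.weight s = 17 →
      ∃ b : List ℕ →₀ ℚ, (∀ t ∈ b.support, MZV.IsHoffman t ∧ MZV.weight t = MZV.weight s) ∧ ∀ (R : Type) [CommRing R] [Algebra ℚ R] [IsReduced R] (φ : NCSeries Bool R), NCSeries.IsGroupLike φ → NCSeries.DrinfeldPentagon φ → φ (MZV.binaryWord s) = b.sum (fun t q => q • φ (MZV.binaryWord t))) →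
    (∀ s : List ℕ, MZV.IsAdmissible s → 18 ≤ MZV.weight s →
      (∀ c m : ℕ, 1 ≤ c → 1 ≤ m → s ≠ List.replicate m (2 * c)) →
      (∀ n : ℕ, s ≠ (List.replicate n [3, 1]).flatten) →
      (∀ c m : ℕ, 1 ≤ c → 1 ≤ m → MZV.dual s ≠ List.replicate m (2 * c)) →
      ¬ MZV.IsHoffman (MZV.dual s) →
      ∃ b : List ℕ →₀ ℚ, (∀ t ∈ b.support, MZV.IsHoffman t ∧ MZV.weight t = MZV.weight s) ∧ ∀ (R : Type) [CommRing R] [Algebra ℚ R] [IsReduced R] (φ : NCSeries Bool R), NCSeries.IsGroupLike φ → NCSeries.DrinfeldPentagon φ → φ (MZV.binaryWord s) = b.sum (fun t q => q • φ (MZV.binaryWord t))) →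
    AssociatorHoffmanSpanning := by
  intro h17 hres s hs
  by_cases h16 : MZV.weight s ≤ 16
  · exact stub_associatorHoffmanSpanning_of_weight_le_16 s hs h16
  by_cases hw17 : MZV.weight s = 17
  · exact h17 s hs hw17
  by_cases hr : ∃ c m : ℕ, 1 ≤ c ∧ 1 ≤ m ∧ s = List.replicate m (2 * c)
  · obtain ⟨c, m, hc, hm, rfl⟩ := hr
    exact leaf_replicateEven c m hc hm
  by_cases ht : ∃ n : ℕ, s = (List.replicate n [3, 1]).flatten
  · obtain ⟨n, rfl⟩ := ht
    exact leaf_threeOne n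
  by_cases hd : ∃ c m : ℕ, 1 ≤ c ∧ 1 ≤ m ∧ MZV.dual s = List.replicate m (2 * c)
  · obtain ⟨c, m, hc, hm, hcm⟩ := hd
    exact stub_leafOfDual s hs (hcm ▸ leaf_replicateEven c m hc hm)
  by_cases hh : MZV.IsHoffman (MZV.dual s)
  · exact stub_leafOfDual s hs (leafLowWeight_of_isHoffman hh)
  push Not at hr ht hd
  exact hres s hs (by omega) (fun c m hc hm => hr c m hc hm) ht (fun c m hc hm => hd c m hc hm) hh

/-- **The child crux from the registered stubs, by name** (the skeleton's concluding theorem). [folklore] -/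
theorem AssociatorHoffmanSpanning_of : AssociatorHoffmanSpanning :=
  associatorHoffmanSpanning_of_slices stub_leafWeightSeventeen stub_residual_ge_18

end Summit.KontsevichZagierPeriods.KontsevichZagierPeriods.Cruxes.AssociatorHoffmanSpanning.WeightFrontier

end
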